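import Mathlib
import Literature.NumberTheory.LFunctions.Zhang2022.Section10Range1113RelW
import Literature.NumberTheory.LFunctions.Zhang2022.Section10Lemma102Windows
import Literature.NumberTheory.LFunctions.Zhang2022.SkeletonLemma102RelW
import Literature.NumberTheory.LFunctions.Zhang2022.AppendixALemma83RelHolds
import HarnessLib

/-!
# Zhang (2022) §10 p. 57: the first line of the top range of `Θ₁(𝐚₁₁,𝐚₁₃)` (`Z22:§10.u038`,
# `Typed.Sec10B.Eq1038a`) at the window rate OF RECORD (R-26), and OUTRIGHT

Topic `Literature/NumberTheory/LFunctions/Zhang2022` (Landau–Siegel adjudication tree;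
verdict-neutral). Y. Zhang, *Discrete mean estimates and the Landau–Siegel zero*,
arXiv:2211.02515v1 (2022) [Zhang2022LandauSiegel], §10 «Proof of Proposition 2.4», PDF p. 57
(tex L2941): "the sum over `P^{0.502} ≤ dr < P^{0.504}` is equal to `(500L′(1,χ)²/(0.504 log²P))
Σ_{P^{0.502}≤n<P^{0.504}} |χ(n)|λ₀ⱼ(n)φ(n)⁻¹𝔣_{j6}(P^{0.504}/n)(1 + 𝔶₂ⱼ(n)) + o(α)`" — **an unrefereed
manuscript under adjudication; this file proves ONE of its displayed steps and asserts nothing about its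
Theorems 1–2 or about Landau–Siegel zeros.** ZHANG-L discharge lane (WP10, seat zl-w10-p5, helper under
the leaf `Typed.Sec10B.Concl1113`, split with zl-w10-p3 of 2026-08-26T23:40Z: p3 = (10.36a)/(10.37a) +
assembly, p5 = (10.38a)).

Why a third file. `Section10Range1113Top.eq1038a_of` (sz-d41) consumes the printed Lemma 10.2;
`Section10Range1113TopRelW.eq1038a_of_relW` (this seat) the relative clauses with the window clause at
the rate `C𝓛⁻⁷R(d,r)`, which the lane's referees found underivable (one SHORT log-mean per window;
zl-w10-ref-2 / zl-w10-p6, RETYPE-LEDGER RT-01′, ruling R-26/R-26a). The window clause OF RECORD is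
`‖𝔳₂ⱼ(d,r)‖ ≤ C·𝓛·(1 + log T)⁴/log P·R(d,r)` (`R(d,r) = (∏_{q∣dr}(1−q⁻¹)⁻¹)²`, `log T = 𝓛^{1.1}`,
`log P = 𝓛⁹`; ≈ `C𝓛^{−3.6}R`) — the clause 4 of `Skeleton.Lemma102RelW` (zl-w10-typer, p475511) and a
THEOREM of the tree (zl-w10-p6's `Lemma102.frakv2_windows_le_of_lemma83Rel`, from `Lemma83Rel`, itself
a theorem `lemma83Rel_holds` since App. A closed). This file re-runs d41's top-range assembly at that
rate: with `t := 𝓛^{1/10}` (`𝓛^{1.1} = 𝓛t`, `𝓛 = t¹⁰`) every quantity is polynomial in `𝓛, t`; the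
window rate is `≤ 16|C|t⁴𝓛⁻⁴`, the crude top-window `m`-sum bound is `4t²𝓛⁻⁷` (from `log x ≤ log T`),
the window weight mass is kept sharp at `e^{256}(5 + 𝓛^{1.1}) ≤ 2e^{256}𝓛t` (d41's `weight_sum_windows 7`),
and the window term is `≪ 𝓛t·t⁶𝓛⁻¹¹ = t⁷𝓛⁻¹⁰ = 𝓛^{−9.3}` against `α = π𝓛⁻⁹` (margin `t³`); the main
range is d41's verbatim at the relative rate (sz-L3-t4's `Ranges1422.range_assembly_bound₃`,
exponent-7 weights).

* `eq1038a_of_rel_clauses` — `Eq1038a c′` ⇐ (10.10)ᴿ (clause 3 of `Skeleton.Lemma102Rel`, inline)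
  ∧ the window clause of record (inline, the text of `Skeleton.Lemma102RelW` clause 4) ∧ `Lemma82 c′`
  ∧ `Eq810` — the shape agreed with zl-w10-p3 for the `Concl1113` assembly;
* `eq1038a_of_lemma102RelW` — the same from the re-typed §10 binder `Skeleton.Lemma102RelW c′`;
* `eq1038a_holds` — **`Typed.Sec10B.Eq1038a c′` OUTRIGHT for `c′ ≥ 0`**: clause 3 and the window
  clause are zl-w10-p6's `Lemma102.eq1010Rel_of_lemma83Rel` / `frakv2_windows_le_of_lemma83Rel` at
  `lemma83Rel_holds c′`, Lemma 8.2 is `lemma82_holds`, (8.10) is `eq810_holds`.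

Theorem-only; 0 new definitions, 0 facts.

## References

* Y. Zhang, arXiv:2211.02515v1 (2022), §10 p. 57 (tex L2935–2945), Lemma 10.2 p. 55, Lemma 8.2
  p. 46, (8.10) p. 48. [cite: Zhang2022LandauSiegel, §10 p.57]
-/

noncomputable section

open Complex Real Finset

namespace Literature.NumberTheory.LFunctions.Zhang2022.Skeleton

open Literature.NumberTheory.LFunctions.Zhang2022.Typed
open Literature.NumberTheory.LFunctions.Zhang2022.Typed.Sec10C.Ranges1422 (range_assembly_bound₃)
open Literature.NumberTheory.LFunctions.Zhang2022.Section8cProofs (large_D)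
open Literature.NumberTheory.LFunctions.Zhang2022.Sj1321Mid (prod_one_sub_inv_inv_sq_eq)

/-! ## Arithmetic at the window rate of record (`t = 𝓛^{1/10}`) -/

/-- For `𝓛 ≥ 1` and `t = 𝓛^{1/10}`: `t ≥ 1`, `𝓛 = t¹⁰`, `𝓛^{1.1} = 𝓛·t` (the exponent `1.1` of
`log T = 𝓛^{1.1}`, (2.8), made polynomial). [cite: Zhang2022LandauSiegel, §2 (2.1), (2.8)] -/
theorem tenth_root_facts {L : ℝ} (hL1 : 1 ≤ L) :
    1 ≤ L ^ ((10 : ℝ)⁻¹) ∧ L = (L ^ ((10 : ℝ)⁻¹)) ^ 10 ∧ L ^ (1.1 : ℝ) = L * L ^ ((10 : ℝ)⁻¹) := by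
  have hL0 : 0 < L := by linarith
  refine ⟨Real.one_le_rpow hL1 (by norm_num), ?_, ?_⟩
  · rw [← Real.rpow_natCast, ← Real.rpow_mul hL0.le]
    norm_num
  · rw [show (1.1 : ℝ) = 1 + (10 : ℝ)⁻¹ by norm_num, Real.rpow_add hL0, Real.rpow_one]

/-- `t = 𝓛^{1/10} ≥ Y` once `𝓛 ≥ Y¹⁰` (`Y ≥ 0`) — the threshold form of "for all large `D`" used with
`log T = 𝓛^{1.1}`. [cite: Zhang2022LandauSiegel, §2 (2.1), (2.8)] -/
theorem tenth_root_ge {L Y : ℝ} (hY : 0 ≤ Y) (hL : Y ^ 10 ≤ L) : Y ≤ L ^ ((10 : ℝ)⁻¹) := by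
  have h := Real.rpow_le_rpow (pow_nonneg hY 10) hL (by norm_num : (0 : ℝ) ≤ (10 : ℝ)⁻¹)
  have e : (Y ^ 10) ^ ((10 : ℝ)⁻¹) = Y := by
    have := Real.pow_rpow_inv_natCast hY (n := 10) (by norm_num)
    simpa using this
  rwa [e] at h

/-- The R-26 window rate in polynomial form: for `L ≥ 1`, `t ≥ 1`, `L^{1.1} = Lt`,
`C·L·(1 + L^{1.1})⁴/L⁹ ≤ 16|C|t⁴L⁻⁴`. [cite: Zhang2022LandauSiegel, §10 (10.11)] -/
theorem window_rate_le {L t C : ℝ} (hL1 : 1 ≤ L) (ht1 : 1 ≤ t) (hτ : L ^ (1.1 : ℝ) = L * t) :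
    C * L * (1 + L ^ (1.1 : ℝ)) ^ 4 / L ^ 9 ≤ 16 * |C| * t ^ 4 * (L ^ 4)⁻¹ := by
  have hL0 : 0 < L := by linarith
  have ht0 : 0 < t := by linarith
  rw [hτ]
  have hLt : 1 ≤ L * t := one_le_mul_of_one_le_of_one_le hL1 ht1
  have h1 : (1 + L * t) ^ 4 ≤ (2 * (L * t)) ^ 4 :=
    pow_le_pow_left₀ (by positivity) (by linarith) 4
  have h2 : C * L * (1 + L * t) ^ 4 / L ^ 9 ≤ |C| * L * (1 + L * t) ^ 4 / L ^ 9 := by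
    have : 0 ≤ L * (1 + L * t) ^ 4 / L ^ 9 := by positivity
    calc C * L * (1 + L * t) ^ 4 / L ^ 9 = C * (L * (1 + L * t) ^ 4 / L ^ 9) := by ring
      _ ≤ |C| * (L * (1 + L * t) ^ 4 / L ^ 9) := mul_le_mul_of_nonneg_right (le_abs_self C) this
      _ = |C| * L * (1 + L * t) ^ 4 / L ^ 9 := by ring
  calc C * L * (1 + L * t) ^ 4 / L ^ 9 ≤ |C| * L * (1 + L * t) ^ 4 / L ^ 9 := h2
    _ ≤ |C| * L * (2 * (L * t)) ^ 4 / L ^ 9 := by gcongr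
    _ = 16 * |C| * t ^ 4 * (L ^ 4)⁻¹ := by field_simp; ring

/-- The window constants at the R-26 rate: with `B_M`, `e_M` as in d41's assembly, the crude top-window
`m`-bound `4t²L⁻⁷`, the window rate `c_W t⁴L⁻⁴` and `|c₀| ≤ 2000e^{9/2}L⁻⁷`:
`(B_M + e_M + 4t²L⁻⁷)·c_W t⁴L⁻⁴ + 2B_M|c₀| ≤ ((254e^{9/2} + 2|C₂| + 4)c_W + 1016000e⁹)·t⁶L⁻¹¹`.
[cite: Zhang2022LandauSiegel, §10 p. 57] -/
theorem consts_bound_weak {L t C₂ cW c0 : ℝ} (hL1 : 1 ≤ L) (ht1 : 1 ≤ t) (hcW : 0 ≤ cW)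
    (hc0 : 0 ≤ c0) (hc0le : c0 ≤ 2000 * Real.exp (9 / 2) * (L ^ 7)⁻¹) :
    (4 * Real.exp (9 / 2) * L ^ 2 * 32 / (0.504 * L ^ 9) + |C₂| * (L ^ 6)⁻¹ / (0.504 * L ^ 9) +
          4 * t ^ 2 * (L ^ 7)⁻¹) * (cW * t ^ 4 * (L ^ 4)⁻¹) +
        4 * Real.exp (9 / 2) * L ^ 2 * 32 / (0.504 * L ^ 9) * c0 * 2 ≤
      ((254 * Real.exp (9 / 2) + 2 * |C₂| + 4) * cW + 1016000 * Real.exp 9) * t ^ 6 *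
        (L ^ 11)⁻¹ := by
  have hL0 : 0 < L := by linarith
  have ht0 : 0 < t := by linarith
  set u : ℝ := (L ^ 7)⁻¹ with hu
  set v : ℝ := (L ^ 4)⁻¹ with hv
  have hu0 : 0 < u := by positivity
  have hv0 : 0 < v := by positivity
  have huv : u ≤ v := by
    rw [hu, hv, inv_le_inv₀ (by positivity) (by positivity)]
    exact pow_le_pow_right₀ hL1 (by norm_num)
  have huv11 : u * v = (L ^ 11)⁻¹ := by rw [hu, hv]; field_simp
  have ht2 : 1 ≤ t ^ 2 := one_le_pow₀ ht1
  have ht6 : 1 ≤ t ^ 6 := one_le_pow₀ ht1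
  -- `B_M ≤ 254e^{9/2}u`, `e_M ≤ 2|C₂|u`
  have hBM : 4 * Real.exp (9 / 2) * L ^ 2 * 32 / (0.504 * L ^ 9) ≤ 254 * Real.exp (9 / 2) * u := by
    have e : 4 * Real.exp (9 / 2) * L ^ 2 * 32 / (0.504 * L ^ 9) =
        (128 / 0.504) * Real.exp (9 / 2) * (L ^ 7)⁻¹ := by
      field_simp; ring
    rw [e, hu]
    gcongr
    norm_num
  have hBM0 : 0 ≤ 4 * Real.exp (9 / 2) * L ^ 2 * 32 / (0.504 * L ^ 9) := by positivity
  have hEM : |C₂| * (L ^ 6)⁻¹ / (0.504 * L ^ 9) ≤ 2 * |C₂| * u := by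
    have e : |C₂| * (L ^ 6)⁻¹ / (0.504 * L ^ 9) = (1 / 0.504) * |C₂| * (L ^ 15)⁻¹ := by
      field_simp
    have h15 : (L ^ 15)⁻¹ ≤ u := by
      rw [hu, inv_le_inv₀ (by positivity) (by positivity)]
      exact pow_le_pow_right₀ hL1 (by norm_num)
    rw [e]
    calc 1 / 0.504 * |C₂| * (L ^ 15)⁻¹ ≤ 1 / 0.504 * |C₂| * u := by gcongr
      _ ≤ 2 * |C₂| * u := by gcongr; norm_num
  -- `B_W ≤ b t² u`
  have hBW : 4 * Real.exp (9 / 2) * L ^ 2 * 32 / (0.504 * L ^ 9) + |C₂| * (L ^ 6)⁻¹ / (0.504 * L ^ 9) +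
      4 * t ^ 2 * (L ^ 7)⁻¹ ≤ (254 * Real.exp (9 / 2) + 2 * |C₂| + 4) * t ^ 2 * u := by
    rw [← hu]
    have h1 : 254 * Real.exp (9 / 2) * u ≤ 254 * Real.exp (9 / 2) * t ^ 2 * u := by
      calc 254 * Real.exp (9 / 2) * u = 254 * Real.exp (9 / 2) * 1 * u := by ring
        _ ≤ 254 * Real.exp (9 / 2) * t ^ 2 * u := by gcongr
    have h2 : 2 * |C₂| * u ≤ 2 * |C₂| * t ^ 2 * u := by
      calc 2 * |C₂| * u = 2 * |C₂| * 1 * u := by ring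
        _ ≤ 2 * |C₂| * t ^ 2 * u := by gcongr
    calc _ ≤ 254 * Real.exp (9 / 2) * u + 2 * |C₂| * u + 4 * t ^ 2 * u :=
          add_le_add (add_le_add hBM hEM) le_rfl
      _ ≤ 254 * Real.exp (9 / 2) * t ^ 2 * u + 2 * |C₂| * t ^ 2 * u + 4 * t ^ 2 * u := by
          linarith
      _ = (254 * Real.exp (9 / 2) + 2 * |C₂| + 4) * t ^ 2 * u := by ring
  have hBW0 : 0 ≤ 4 * Real.exp (9 / 2) * L ^ 2 * 32 / (0.504 * L ^ 9) +
      |C₂| * (L ^ 6)⁻¹ / (0.504 * L ^ 9) + 4 * t ^ 2 * (L ^ 7)⁻¹ := by positivity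
  -- first summand
  have hS1 : (4 * Real.exp (9 / 2) * L ^ 2 * 32 / (0.504 * L ^ 9) + |C₂| * (L ^ 6)⁻¹ / (0.504 * L ^ 9) +
        4 * t ^ 2 * (L ^ 7)⁻¹) * (cW * t ^ 4 * (L ^ 4)⁻¹) ≤
      (254 * Real.exp (9 / 2) + 2 * |C₂| + 4) * cW * t ^ 6 * (u * v) := by
    rw [← hv]
    calc _ ≤ ((254 * Real.exp (9 / 2) + 2 * |C₂| + 4) * t ^ 2 * u) * (cW * t ^ 4 * v) :=
          mul_le_mul_of_nonneg_right hBW (by positivity)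
      _ = (254 * Real.exp (9 / 2) + 2 * |C₂| + 4) * cW * t ^ 6 * (u * v) := by ring
  -- second summand
  have he9 : Real.exp (9 / 2) * Real.exp (9 / 2) = Real.exp 9 := by
    rw [← Real.exp_add]; norm_num
  have hS2 : 4 * Real.exp (9 / 2) * L ^ 2 * 32 / (0.504 * L ^ 9) * c0 * 2 ≤
      1016000 * Real.exp 9 * t ^ 6 * (u * v) := by
    calc 4 * Real.exp (9 / 2) * L ^ 2 * 32 / (0.504 * L ^ 9) * c0 * 2
        ≤ (254 * Real.exp (9 / 2) * u) * (2000 * Real.exp (9 / 2) * (L ^ 7)⁻¹) * 2 := by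
          gcongr
      _ = 1016000 * Real.exp 9 * 1 * (u * u) := by rw [← he9, hu]; ring
      _ ≤ 1016000 * Real.exp 9 * t ^ 6 * (u * v) := by gcongr
  rw [← huv11]
  calc _ ≤ (254 * Real.exp (9 / 2) + 2 * |C₂| + 4) * cW * t ^ 6 * (u * v) +
        1016000 * Real.exp 9 * t ^ 6 * (u * v) := add_le_add hS1 hS2
    _ = ((254 * Real.exp (9 / 2) + 2 * |C₂| + 4) * cW + 1016000 * Real.exp 9) * t ^ 6 *
        (u * v) := by ring

/-- The final numeric step at the R-26 window rate: with `L = t¹⁰`, `t ≥ 1`,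
`W₁ ≤ e^{256}L⁹`, `A₁ ≤ K₁L⁻²²`, `W₂ ≤ 2e^{256}Lt` (window mass `e^{256}(5 + 𝓛^{1.1})`),
`A₂ ≤ K₂t^mL⁻¹¹` (`m + 1 ≤ 9`), once `L ≥ 2e^{256}K₁/(επ)` and `t ≥ 4e^{256}K₂/(επ)`:
`W₁A₁ + W₂A₂ ≤ επL⁻⁹`. [cite: Zhang2022LandauSiegel, §10 p. 57] -/
theorem final_bound_weak {L t ε K₁ K₂ W₁ W₂ A₁ A₂ : ℝ} {m : ℕ} (hm : m + 1 ≤ 9) (ht1 : 1 ≤ t)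
    (hL : L = t ^ 10) (hε : 0 < ε) (hK₁ : 0 ≤ K₁) (hK₂ : 0 ≤ K₂) (hA₁0 : 0 ≤ A₁) (hA₂0 : 0 ≤ A₂)
    (hW₁ : W₁ ≤ Real.exp 256 * L ^ 9) (hW₂ : W₂ ≤ 2 * Real.exp 256 * L * t)
    (hA₁ : A₁ ≤ K₁ * (L ^ 22)⁻¹) (hA₂ : A₂ ≤ K₂ * t ^ m * (L ^ 11)⁻¹)
    (hL₁ : 2 * Real.exp 256 * K₁ / (ε * π) ≤ L) (ht₂ : 4 * Real.exp 256 * K₂ / (ε * π) ≤ t) :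
    W₁ * A₁ + W₂ * A₂ ≤ ε * (π / L ^ 9) := by
  have ht0 : 0 < t := by linarith
  have hL1 : 1 ≤ L := by rw [hL]; exact one_le_pow₀ ht1
  have hL0 : 0 < L := by linarith
  have hεπ : 0 < ε * π := by positivity
  -- term 1
  have h1 : W₁ * A₁ ≤ (ε * π / 2) * (L ^ 9)⁻¹ := by
    have s1 : W₁ * A₁ ≤ (Real.exp 256 * L ^ 9) * (K₁ * (L ^ 22)⁻¹) := by gcongr
    have s2 : (Real.exp 256 * L ^ 9) * (K₁ * (L ^ 22)⁻¹) = Real.exp 256 * K₁ * (L ^ 13)⁻¹ := by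
      field_simp
    have s3 : (L ^ 13)⁻¹ ≤ (L ^ 10)⁻¹ := by
      rw [inv_le_inv₀ (by positivity) (by positivity)]
      exact pow_le_pow_right₀ hL1 (by norm_num)
    have s4 : Real.exp 256 * K₁ ≤ ε * π / 2 * L := by
      have := hL₁
      rw [div_le_iff₀ hεπ] at this
      linarith
    calc W₁ * A₁ ≤ Real.exp 256 * K₁ * (L ^ 13)⁻¹ := by rw [← s2]; exact s1
      _ ≤ Real.exp 256 * K₁ * (L ^ 10)⁻¹ := by gcongr
      _ ≤ (ε * π / 2 * L) * (L ^ 10)⁻¹ := by gcongr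
      _ = (ε * π / 2) * (L ^ 9)⁻¹ := by field_simp
  -- term 2
  have h2 : W₂ * A₂ ≤ (ε * π / 2) * (L ^ 9)⁻¹ := by
    have s1 : W₂ * A₂ ≤ (2 * Real.exp 256 * L * t) * (K₂ * t ^ m * (L ^ 11)⁻¹) := by gcongr
    have s2 : t ^ (m + 1) ≤ t ^ 9 := pow_le_pow_right₀ ht1 hm
    have s3 : (2 * Real.exp 256 * L * t) * (K₂ * t ^ m * (L ^ 11)⁻¹) =
        2 * Real.exp 256 * K₂ * t ^ (m + 1) * (L ^ 10)⁻¹ := by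
      rw [pow_succ]; field_simp; ring
    have s4 : 2 * Real.exp 256 * K₂ * t ^ 9 * (L ^ 10)⁻¹ =
        (2 * Real.exp 256 * K₂ / t) * (L ^ 9)⁻¹ := by
      rw [hL]; field_simp
    have s5 : 2 * Real.exp 256 * K₂ / t ≤ ε * π / 2 := by
      rw [div_le_iff₀ ht0]
      have := ht₂
      rw [div_le_iff₀ hεπ] at this
      linarith
    calc W₂ * A₂ ≤ 2 * Real.exp 256 * K₂ * t ^ (m + 1) * (L ^ 10)⁻¹ := by rw [← s3]; exact s1
      _ ≤ 2 * Real.exp 256 * K₂ * t ^ 9 * (L ^ 10)⁻¹ := by gcongr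
      _ = (2 * Real.exp 256 * K₂ / t) * (L ^ 9)⁻¹ := s4
      _ ≤ (ε * π / 2) * (L ^ 9)⁻¹ := by gcongr
  calc W₁ * A₁ + W₂ * A₂ ≤ (ε * π / 2) * (L ^ 9)⁻¹ + (ε * π / 2) * (L ^ 9)⁻¹ := add_le_add h1 h2
    _ = ε * (π / L ^ 9) := by field_simp; norm_num


/-! ## The top range of `Θ₁(𝐚₁₁,𝐚₁₃)` at the window rate of record -/

variable (c' : ℝ)

set_option maxHeartbeats 400000 in
-- one long assembly proof (three windows, two factor estimates); twice the default budget
/-- **`Z22:§10.u038` (first line) from the relative Lemma 10.2 with the window clause OF RECORD**: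
`Typed.Sec10B.Eq1038a c′` — "the sum over `P^{0.502} ≤ dr < P^{0.504}` [of `Sⱼ(𝐚₁₁,𝐚₁₃)`] is equal to
`(500L′(1,χ)²/(0.504 log²P)) Σ_{P^{0.502}≤n<P^{0.504}} |χ(n)|λ₀ⱼ(n)φ(n)⁻¹𝔣_{j6}(P^{0.504}/n)(1 + 𝔶₂ⱼ(n))
+ o(α)`" (§10 p. 57, tex L2941) — FOLLOWS (kernel-checked) from (10.10)ᴿ (first argument: clause 3 of
`Skeleton.Lemma102Rel`, error `C𝓛⁻¹⁵R(d,r)`), the window clause of record (second argument: clause 4 of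
`Skeleton.Lemma102RelW`, `‖𝔳₂ⱼ‖ ≤ C𝓛(1+log T)⁴/log P·R(d,r)` on the three `T`-windows), Lemma 8.2
(`Skeleton.Lemma82 c′`) and (8.10) (`Section8cStatements.Eq810`); total error
`≪ 𝓛⁹·𝓛⁻²² + 𝓛^{1.1}·𝓛^{0.6}𝓛⁻¹¹ = o(𝓛⁻⁹) = o(α)`. [cite: Zhang2022LandauSiegel, §10 p. 57] -/
theorem eq1038a_of_rel_clauses
    (h10 : ∃ C : ℝ, ForAllLarge fun D _ χ => AssumptionA D χ →
      ∀ j ∈ ({1, 2, 3} : Finset ℕ), ∀ d r : ℕ, 1 ≤ d → 1 ≤ r →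
        bigP D ^ (0.502 : ℝ) < ((d * r : ℕ) : ℝ) →
          ((d * r : ℕ) : ℝ) ≤ bigP D ^ (0.504 : ℝ) / bigT D →
          ‖frakv2 c' χ j d r - 500 * deriv χ.LFunction 1 * PiW χ d r / Real.log (bigP D) *
            (1 + fraky2 c' D j ((d * r : ℕ) : ℝ))‖ ≤
            C * (ell D ^ 15)⁻¹ * (∏ q ∈ (d * r).primeFactors, (1 - (q : ℝ)⁻¹)⁻¹) ^ 2)
    (hW : ∃ C : ℝ, ForAllLarge fun D _ χ => AssumptionA D χ →
      ∀ j ∈ ({1, 2, 3} : Finset ℕ), ∀ d r : ℕ, 1 ≤ d → 1 ≤ r →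
        ((bigP D ^ (0.5 : ℝ) / bigT D < ((d * r : ℕ) : ℝ) ∧ ((d * r : ℕ) : ℝ) ≤ bigP D ^ (0.5 : ℝ)) ∨
            (bigP D ^ (0.502 : ℝ) / bigT D < ((d * r : ℕ) : ℝ) ∧
              ((d * r : ℕ) : ℝ) ≤ bigP D ^ (0.502 : ℝ)) ∨
            (bigP D ^ (0.504 : ℝ) / bigT D < ((d * r : ℕ) : ℝ) ∧
              ((d * r : ℕ) : ℝ) < bigP D ^ (0.504 : ℝ))) →
          ‖frakv2 c' χ j d r‖ ≤
            C * ell D * (1 + Real.log (bigT D)) ^ 4 / Real.log (bigP D) *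
              (∏ q ∈ (d * r).primeFactors, (1 - (q : ℝ)⁻¹)⁻¹) ^ 2)
    (h82 : Lemma82 c') (h810 : Section8cStatements.Eq810) : Sec10B.Eq1038a c' := by
  classical
  intro ε hε
  obtain ⟨C₃, H₃⟩ := h10
  obtain ⟨C₁, H₁⟩ := hW
  obtain ⟨C₂, H₂⟩ := h82
  -- the constants: main range `K₁𝓛⁻²²` (d41), window rate `c_W t⁴𝓛⁻⁴`, window `K₂t⁶𝓛⁻¹¹` (`t = 𝓛^{1/10}`)
  set K₁ : ℝ := (254 * Real.exp (9 / 2) + 2 * |C₂|) * |C₃| + 8000 * Real.exp (9 / 2) * |C₂|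
    with hK₁
  obtain ⟨cW, hcW⟩ : ∃ cW : ℝ, cW = 16 * |C₁| + 4000 * Real.exp (9 / 2) + |C₃| := ⟨_, rfl⟩
  set K₂ : ℝ := (254 * Real.exp (9 / 2) + 2 * |C₂| + 4) * cW + 1016000 * Real.exp 9 with hK₂
  have hK₁0 : 0 ≤ K₁ := by positivity
  have hcW0 : 0 ≤ cW := by rw [hcW]; positivity
  have hK₂0 : 0 ≤ K₂ := by positivity
  obtain ⟨Y, hY⟩ : ∃ Y : ℝ, Y = 4 * Real.exp 256 * K₂ / (ε * π) := ⟨_, rfl⟩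
  have hY0 : 0 ≤ Y := by rw [hY]; positivity
  set X : ℝ := 2 * Real.exp 256 * K₁ / (ε * π) + Y ^ 10 + 5 with hX
  obtain ⟨D₀, hH⟩ := (H₃.and H₁).and H₂
  refine ⟨max D₀ (max ⌈Real.exp (π * |c'| + 5)⌉₊ ⌈Real.exp X⌉₊), fun D _ χ hD hq hp hA j hj => ?_⟩
  have hD₀ : D₀ ≤ D := le_trans (le_max_left _ _) hD
  have hDc : ⌈Real.exp (π * |c'| + 5)⌉₊ ≤ D :=
    le_trans (le_trans (le_max_left _ _) (le_max_right _ _)) hD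
  have hDX : ⌈Real.exp X⌉₊ ≤ D := le_trans (le_trans (le_max_right _ _) (le_max_right _ _)) hD
  obtain ⟨hL5, hα, hcαL⟩ := large_D hDc
  have hLX : X ≤ ell D := by
    have h : Real.exp X ≤ D := le_trans (Nat.le_ceil _) (by exact_mod_cast hDX)
    rw [ell]; exact (Real.le_log_iff_exp_le (lt_of_lt_of_le (Real.exp_pos _) h)).mpr h
  obtain ⟨⟨H₃', H₁'⟩, H₂'⟩ := hH D χ hD₀ hq hp
  replace H₃' := H₃' hA j hj
  replace H₁' := H₁' hA j hj
  replace H₂' := H₂' hA j hj 6 (by simp)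
  -- parameters
  have hlog2 : 2 ≤ Real.log D := by have h := hL5; rw [ell] at h; linarith
  have hL1 : (1 : ℝ) ≤ ell D := by linarith
  have hL0 : (0 : ℝ) < ell D := by linarith
  -- `t = 𝓛^{1/10}`: `t ≥ 1`, `𝓛 = t¹⁰`, `𝓛^{1.1} = 𝓛t`, and the two thresholds
  obtain ⟨ht1, hLt10, hτ⟩ := tenth_root_facts hL1
  set t : ℝ := ell D ^ ((10 : ℝ)⁻¹) with htdef
  have ht0 : 0 < t := by linarith
  have hLmain : 2 * Real.exp 256 * K₁ / (ε * π) ≤ ell D := by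
    rw [hX] at hLX; linarith [pow_nonneg hY0 10]
  have htY : Y ≤ t := by
    rw [htdef]
    refine tenth_root_ge hY0 ?_
    rw [hX] at hLX
    linarith [show (0 : ℝ) ≤ 2 * Real.exp 256 * K₁ / (ε * π) by positivity]
  have hαeq : alpha D = π / ell D ^ 9 := by rw [alpha, bigP, Real.log_exp]
  have hαL : alpha D * ell D ^ 9 = π := by rw [hαeq]; field_simp
  obtain ⟨-, hP2lo5, hT1, hP1⟩ := range_sizes (D := D) hlog2
  obtain ⟨h11, -⟩ := bigT_lt_rpow hL5
  have hhiN : bigP D ^ (0.504 : ℝ) < (Nsupp D : ℝ) :=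
    lt_of_lt_of_le (P1_lt_P_div_T_sq D hlog2) (Nat.le_ceil _)
  have hMT0 := mainTerm_eq_top c' χ hlog2 j
  have hreidx0 := drSum_reindex c' χ j (Sec10B.mSum11 c' χ j) (Sec10B.nSum13 c' χ j)
    (lo := bigP D ^ (0.502 : ℝ)) hhiN
  have h59 : (1953125 : ℝ) ≤ ell D ^ 9 := by
    have h := pow_le_pow_left₀ (by norm_num : (0:ℝ) ≤ 5) hL5 9
    norm_num at h
    exact h
  have h7L : (78125 : ℝ) * ell D ^ 2 ≤ ell D ^ 9 := by
    have hL7 : (78125 : ℝ) ≤ ell D ^ 7 := by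
      have h := pow_le_pow_left₀ (by norm_num : (0:ℝ) ≤ 5) hL5 7
      norm_num at h
      exact h
    calc (78125 : ℝ) * ell D ^ 2 ≤ ell D ^ 7 * ell D ^ 2 := by gcongr
      _ = ell D ^ 9 := by ring
  have hP2lo_raw : P2 D ≤ bigP D ^ (0.502 : ℝ) := by
    refine hP2lo5.trans ?_
    rw [bigP_rpow, bigP_rpow, Real.exp_le_exp]
    linarith [h59]
  set P : ℝ := bigP D with hPdef
  set lo : ℝ := bigP D ^ (0.502 : ℝ) with hlodef
  set hi : ℝ := bigP D ^ (0.504 : ℝ) with hhidef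
  set T : ℝ := bigT D with hTdef
  have hlo_exp : lo = Real.exp (0.502 * ell D ^ 9) := bigP_rpow D 0.502
  have hhi_exp : hi = Real.exp (0.504 * ell D ^ 9) := bigP_rpow D 0.504
  have hP1_exp : P1 D = Real.exp (0.504 * ell D ^ 9) := bigP_rpow D 0.504
  have hlogP : Real.log P = ell D ^ 9 := log_bigP D
  have hT_exp : T = Real.exp (ell D ^ (1.1 : ℝ)) := rfl
  set M : ℕ → ℂ := Sec10B.mSum11 c' χ j with hMdef
  set N : ℕ → ℕ → ℂ := Sec10B.nSum13 c' χ j with hNdef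
  set S : Finset ℕ := (Finset.Ico 1 (Nsupp D)).filter (fun n : ℕ => lo ≤ (n : ℝ) ∧ (n : ℝ) < hi)
    with hSdef
  clear_value P lo hi T M N S
  have hP0 : 0 < P := lt_trans zero_lt_one hP1
  have hlo0 : 0 < lo := by rw [hlo_exp]; exact Real.exp_pos _
  have hhi0 : 0 < hi := by rw [hhi_exp]; exact Real.exp_pos _
  have hT0 : 0 < T := lt_of_lt_of_le zero_lt_one hT1
  have hT1' : 1 < T := by
    rw [hT_exp]; exact Real.one_lt_exp_iff.mpr (Real.rpow_pos_of_pos hL0 _)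
  have hP1pos : 0 < P1 D := by rw [hP1_exp]; exact Real.exp_pos _
  have hlogP1 : Real.log (P1 D) = 0.504 * ell D ^ 9 := by rw [hP1_exp, Real.log_exp]
  have hlogP1pos : 0 < Real.log (P1 D) := by rw [hlogP1]; positivity
  have hlogT : Real.log T = ell D ^ (1.1 : ℝ) := by rw [hT_exp, Real.log_exp]
  have hhiT_exp : hi / T = Real.exp (0.504 * ell D ^ 9 - ell D ^ (1.1 : ℝ)) := by
    rw [hhi_exp, hT_exp, ← Real.exp_sub]
  have hP2lo : P2 D ≤ lo := hP2lo_raw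
  have hlohiT : lo < hi / T := by
    rw [hlo_exp, hhiT_exp, Real.exp_lt_exp]
    have h2pos : 0 < ell D ^ 2 := pow_pos hL0 2
    linarith [h11, h7L]
  -- opaque objects
  obtain ⟨a, hadef⟩ : ∃ a : ℕ → ℂ, a = fun n : ℕ => (‖χ (n : ZMod D)‖ : ℂ) * lamZero c' D j n / (n : ℂ) :=
    ⟨_, rfl⟩
  obtain ⟨M₀, hM₀def⟩ : ∃ M₀ : ℕ → ℂ, M₀ = fun n : ℕ => deriv χ.LFunction 1 *
      frakfW c' D j 6 (P1 D / n) / (Real.log (P1 D) : ℂ) := ⟨_, rfl⟩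
  obtain ⟨G, hGdef⟩ : ∃ G : ℕ → ℂ, G = fun n : ℕ => 1 + fraky2 c' D j n := ⟨_, rfl⟩
  obtain ⟨c₀, hc₀def⟩ : ∃ c₀ : ℂ, c₀ = 500 * deriv χ.LFunction 1 / (Real.log P : ℂ) := ⟨_, rfl⟩
  obtain ⟨main, hmaindef⟩ : ∃ main : ℕ → Prop, main = fun n : ℕ => lo < (n : ℝ) ∧ (n : ℝ) < hi / T :=
    ⟨_, rfl⟩
  have hmemS : ∀ {n : ℕ}, n ∈ S → 1 ≤ n ∧ lo ≤ (n : ℝ) ∧ (n : ℝ) < hi := by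
    intro n hn
    rw [hSdef, Finset.mem_filter, Finset.mem_Ico] at hn
    exact ⟨hn.1.1, hn.2.1, hn.2.2⟩
  have hSne : ∀ n ∈ S, n ≠ 0 := fun n hn => by have := (hmemS hn).1; omega
  -- (A) re-indexing
  have hreidx : Sec10B.drSum c' χ j M N lo hi =
      ∑ n ∈ S, ∑ r ∈ n.divisors,
        (if Squarefree r then a n / (Nat.totient r : ℂ) * M n * N (n / r) r else 0) := by
    rw [hadef]; exact hreidx0
  -- (B) hypotheses
  have hμ6 : betaMu D 6 = beta6 D := by simp [betaMu]
  have hxfacts : ∀ {n : ℕ}, n ∈ S →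
      1 ≤ P1 D / n ∧ P1 D / n < P ∧ 0 ≤ Real.log (P1 D / n) ∧
      Real.log (P1 D / n) ≤ 0.002 * ell D ^ 9 ∧ |Real.log (hi / n)| ≤ 0.004 * ell D ^ 9 ∧
      ((n : ℝ) < hi / T → T < P1 D / n) ∧ (hi / T ≤ (n : ℝ) → Real.log (P1 D / n) ≤ ell D ^ (1.1 : ℝ)) := by
    intro n hn
    obtain ⟨hn1, hlon, hnhi⟩ := hmemS hn
    rw [hlodef] at hlon
    rw [hhidef] at hnhi ⊢
    rw [hTdef, hPdef]
    exact range_xfacts_top hL5 hn1 hlon hnhi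
  have hLp : ‖deriv χ.LFunction 1‖ ≤ 4 * Real.exp (9 / 2) * ell D ^ 2 :=
    norm_deriv_LFunction_one_le χ (by linarith) hp
  -- (B1) `M = M₀ + O(eM)` for `n < hi/T`
  have hMfull : ∀ n ∈ S, (n : ℝ) < hi / T →
      ‖M n - M₀ n‖ ≤ |C₂| * (ell D ^ 6)⁻¹ / (0.504 * ell D ^ 9) := by
    intro n hn hnT
    obtain ⟨hn1, hlon, hnhi⟩ := hmemS hn
    obtain ⟨-, hxP, -, -, -, hTx, -⟩ := hxfacts hn
    have hTx := hTx hnT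
    have hP2n : P2 D ≤ (n : ℝ) := hP2lo.trans hlon
    have hMn : M n = (1 / (Real.log (P1 D) : ℂ)) * ∑ m ∈ Finset.Ico 1 ⌈P1 D / n⌉₊,
        χ (m : ZMod D) / (m : ℂ) ^ (1 - betaJ c' D j) *
          (((P1 D / n) / m : ℝ) : ℂ) ^ beta6 D * (Real.log ((P1 D / n) / m) : ℂ) := by
      rw [hMdef]; exact mSum11_eq c' χ hlog2 j hn1 hP2n
    have h82 := H₂' (P1 D / n) hTx hxP
    rw [hμ6] at h82
    have hdiff : M n - M₀ n = (1 / (Real.log (P1 D) : ℂ)) *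
        ((∑ m ∈ Finset.Ico 1 ⌈P1 D / n⌉₊, χ (m : ZMod D) / (m : ℂ) ^ (1 - betaJ c' D j) *
          (((P1 D / n) / m : ℝ) : ℂ) ^ beta6 D * (Real.log ((P1 D / n) / m) : ℂ)) -
          deriv χ.LFunction 1 * frakfW c' D j 6 (P1 D / n)) := by
      rw [hMn, hM₀def]
      have : (Real.log (P1 D) : ℂ) ≠ 0 := by exact_mod_cast hlogP1pos.ne'
      field_simp
    rw [hdiff, norm_mul, norm_div, norm_one, Complex.norm_real, Real.norm_of_nonneg hlogP1pos.le,
      hlogP1]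
    have h82' := h82.trans (mul_le_mul_of_nonneg_right (le_abs_self C₂) (by positivity))
    calc 1 / (0.504 * ell D ^ 9) * _ ≤ 1 / (0.504 * ell D ^ 9) * (|C₂| * (ell D ^ 6)⁻¹) := by
          gcongr
      _ = |C₂| * (ell D ^ 6)⁻¹ / (0.504 * ell D ^ 9) := by ring
  have hM : ∀ n ∈ S, main n → ‖M n - M₀ n‖ ≤ |C₂| * (ell D ^ 6)⁻¹ / (0.504 * ell D ^ 9) := by
    intro n hn hmain
    have hmain' : lo < (n : ℝ) ∧ (n : ℝ) < hi / T := by rw [hmaindef] at hmain; exact hmain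
    exact hMfull n hn hmain'.2
  -- (B2) `|M₀| ≤ BM`
  have hM₀ : ∀ n ∈ S, ‖M₀ n‖ ≤ 4 * Real.exp (9 / 2) * ell D ^ 2 * 32 / (0.504 * ell D ^ 9) := by
    intro n hn
    obtain ⟨-, -, hlx0, hlx, -, -, -⟩ := hxfacts hn
    have hlx' : |Real.log (P1 D / n)| ≤ ell D ^ 9 := by
      rw [abs_of_nonneg hlx0]; linarith [h59]
    have hf := norm_frakfW_six_le hcαL hα hαL hL0.le j hlx'
    rw [hM₀def]
    simp only
    rw [norm_div, norm_mul, Complex.norm_real, Real.norm_of_nonneg hlogP1pos.le, hlogP1]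
    gcongr
  -- (B2') `|M| ≤ B_W := B_M + e_M + 4t²𝓛⁻⁷` off the main range
  have hMW : ∀ n ∈ S, ¬ main n → ‖M n‖ ≤
      4 * Real.exp (9 / 2) * ell D ^ 2 * 32 / (0.504 * ell D ^ 9) +
        |C₂| * (ell D ^ 6)⁻¹ / (0.504 * ell D ^ 9) + 4 * t ^ 2 * (ell D ^ 7)⁻¹ := by
    intro n hn hmain
    obtain ⟨hn1, hlon, hnhi⟩ := hmemS hn
    obtain ⟨hx1, -, hlx0, hlx2, -, -, hlxT⟩ := hxfacts hn
    have hP2n : P2 D ≤ (n : ℝ) := hP2lo.trans hlon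
    have hextra : 0 ≤ 4 * t ^ 2 * (ell D ^ 7)⁻¹ := by positivity
    have heM0' : 0 ≤ |C₂| * (ell D ^ 6)⁻¹ / (0.504 * ell D ^ 9) := by positivity
    have hBM0' : 0 ≤ 4 * Real.exp (9 / 2) * ell D ^ 2 * 32 / (0.504 * ell D ^ 9) := by positivity
    rw [hmaindef] at hmain
    simp only [not_and_or, not_lt] at hmain
    rcases hmain with h | h
    · -- the point `n = P^{0.502}`: `M ≈ M₀`, `|M₀| ≤ B_M`
      have hnT : (n : ℝ) < hi / T := lt_of_le_of_lt h hlohiT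
      have h1 := hMfull n hn hnT
      have h2 := hM₀ n hn
      have h3 : ‖M n‖ ≤ ‖M₀ n‖ + ‖M n - M₀ n‖ := norm_le_norm_add_norm_sub' (M n) (M₀ n)
      linarith
    · -- the top window `n ≥ P₁/T`: crude bound with `log x ≤ log T = 𝓛^{1.1} = 𝓛t`
      have hlxT := hlxT h
      have hMn : M n = (1 / (Real.log (P1 D) : ℂ)) * ∑ m ∈ Finset.Ico 1 ⌈P1 D / n⌉₊,
          χ (m : ZMod D) / (m : ℂ) ^ (1 - betaJ c' D j) *
            (((P1 D / n) / m : ℝ) : ℂ) ^ beta6 D * (Real.log ((P1 D / n) / m) : ℂ) := by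
        rw [hMdef]; exact mSum11_eq c' χ hlog2 j hn1 hP2n
      have hcr := norm_lemma82Sum_crude c' χ j hx1
      rw [hMn, norm_mul, norm_div, norm_one, Complex.norm_real, Real.norm_of_nonneg hlogP1pos.le,
        hlogP1]
      have hlogx_le : Real.log (P1 D / n) ≤ ell D * t := by rw [← hτ]; exact hlxT
      have hLt1 : 1 ≤ ell D * t := one_le_mul_of_one_le_of_one_le hL1 ht1
      have hbound : (1 + Real.log (P1 D / n)) * Real.log (P1 D / n) ≤ 2 * (ell D * t) ^ 2 := by
        calc (1 + Real.log (P1 D / n)) * Real.log (P1 D / n)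
            ≤ (1 + ell D * t) * (ell D * t) :=
              mul_le_mul (by linarith) hlogx_le hlx0 (by positivity)
          _ ≤ (ell D * t + ell D * t) * (ell D * t) := by gcongr
          _ = 2 * (ell D * t) ^ 2 := by ring
      calc 1 / (0.504 * ell D ^ 9) * _ ≤ 1 / (0.504 * ell D ^ 9) * (2 * (ell D * t) ^ 2) := by
            gcongr; exact hcr.trans hbound
        _ = (2 / 0.504) * t ^ 2 * (ell D ^ 7)⁻¹ := by field_simp
        _ ≤ 4 * t ^ 2 * (ell D ^ 7)⁻¹ := by gcongr; norm_num
        _ ≤ _ := by linarith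
  -- (B3) `|G| ≤ 2`
  have hG : ∀ n ∈ S, ‖G n‖ ≤ 2 := by
    intro n hn
    obtain ⟨-, -, -, -, h2, -, -⟩ := hxfacts hn
    rw [hhidef] at h2
    rw [hGdef]
    exact norm_fraky2_add_le hcαL hα hαL hL0.le j h2
  -- (B4) main `n`: (10.10), relative
  have hN : ∀ n ∈ S, main n → ∀ r ∈ n.divisors, Squarefree r →
      ‖N (n / r) r - c₀ * PiW χ (n / r) r * G n‖ ≤
        |C₃| * (ell D ^ 15)⁻¹ * ((n : ℝ) / Nat.totient n) ^ 2 := by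
    intro n hn hmain r hr _
    obtain ⟨hn1, -, -⟩ := hmemS hn
    have hr0 : 0 < r := Nat.pos_of_mem_divisors hr
    have hrn : r ∣ n := (Nat.mem_divisors.mp hr).1
    have hnr : n / r * r = n := Nat.div_mul_cancel hrn
    have hd1 : 1 ≤ n / r := Nat.div_pos (Nat.le_of_dvd (by omega) hrn) hr0
    have hcast : ((n / r * r : ℕ) : ℝ) = n := by rw [hnr]
    have hNeq : N (n / r) r = frakv2 c' χ j (n / r) r := by
      rw [hNdef]; exact nSum13_eq_frakv2 c' χ hlog2 j hd1 hr0
    have hmain' : lo < (n : ℝ) ∧ (n : ℝ) < hi / T := by rw [hmaindef] at hmain; exact hmain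
    have h := H₃' (n / r) r hd1 hr0 (by rw [hcast]; exact hmain'.1)
      (by rw [hcast]; exact hmain'.2.le)
    rw [hcast, hnr, prod_one_sub_inv_inv_sq_eq (hSne n hn)] at h
    rw [hNeq, hGdef, hc₀def]
    simp only
    refine le_trans (le_of_eq ?_) (h.trans ?_)
    · congr 1; ring
    · gcongr; exact le_abs_self _
  -- (B5) window `n`: (10.11), or (10.10) at the boundary point `n = P₁/T`
  have hc₀' : ‖c₀‖ ≤ 2000 * Real.exp (9 / 2) * (ell D ^ 7)⁻¹ := by
    rw [hc₀def, norm_div, norm_mul, Complex.norm_real, Real.norm_of_nonneg (by rw [hlogP]; positivity),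
      hlogP]
    have h500 : ‖(500 : ℂ)‖ = 500 := by norm_num
    rw [h500, div_eq_mul_inv]
    have : (2000 : ℝ) * Real.exp (9 / 2) * (ell D ^ 7)⁻¹ =
        500 * (4 * Real.exp (9 / 2) * ell D ^ 2) * (ell D ^ 9)⁻¹ := by
      field_simp; ring
    rw [this]
    gcongr
  have hW : ∀ n ∈ S, ¬ main n → ∀ r ∈ n.divisors, Squarefree r →
      ‖N (n / r) r‖ ≤ cW * t ^ 4 * (ell D ^ 4)⁻¹ * ((n : ℝ) / Nat.totient n) ^ 2 := by
    intro n hn hmain r hr _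
    obtain ⟨hn1, hlon, hnhi⟩ := hmemS hn
    have hr0 : 0 < r := Nat.pos_of_mem_divisors hr
    have hrn : r ∣ n := (Nat.mem_divisors.mp hr).1
    have hnr : n / r * r = n := Nat.div_mul_cancel hrn
    have hd1 : 1 ≤ n / r := Nat.div_pos (Nat.le_of_dvd (by omega) hrn) hr0
    have hcast : ((n / r * r : ℕ) : ℝ) = n := by rw [hnr]
    have hNeq : N (n / r) r = frakv2 c' χ j (n / r) r := by
      rw [hNdef]; exact nSum13_eq_frakv2 c' χ hlog2 j hd1 hr0
    have hΛ : (1 : ℝ) ≤ ((n : ℝ) / Nat.totient n) ^ 2 := one_le_pow₀ (one_le_self_div_totient (by omega))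
    have hl7_le : (ell D ^ 7)⁻¹ ≤ t ^ 4 * (ell D ^ 4)⁻¹ := by
      have h74 : (ell D ^ 7)⁻¹ ≤ (ell D ^ 4)⁻¹ := by
        rw [inv_le_inv₀ (by positivity) (by positivity)]
        exact pow_le_pow_right₀ hL1 (by norm_num)
      calc (ell D ^ 7)⁻¹ ≤ 1 * (ell D ^ 4)⁻¹ := by rw [one_mul]; exact h74
        _ ≤ t ^ 4 * (ell D ^ 4)⁻¹ := by gcongr; exact one_le_pow₀ ht1
    have hl15_le : (ell D ^ 15)⁻¹ ≤ t ^ 4 * (ell D ^ 4)⁻¹ := by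
      refine le_trans ?_ hl7_le
      rw [inv_le_inv₀ (by positivity) (by positivity)]
      exact pow_le_pow_right₀ hL1 (by norm_num)
    rw [hmaindef] at hmain
    simp only [not_and_or, not_lt] at hmain
    -- the generic window bound from the R-26 rate `C₁𝓛(1+log T)⁴/log P ≤ 16|C₁|t⁴𝓛⁻⁴`
    have hrate : C₁ * ell D * (1 + Real.log T) ^ 4 / Real.log P ≤ 16 * |C₁| * t ^ 4 * (ell D ^ 4)⁻¹ := by
      rw [hlogT, hlogP]; exact window_rate_le hL1 ht1 hτ
    have from_window : ‖frakv2 c' χ j (n / r) r‖ ≤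
        C₁ * ell D * (1 + Real.log T) ^ 4 / Real.log P *
          (∏ q ∈ (n / r * r).primeFactors, (1 - (q : ℝ)⁻¹)⁻¹) ^ 2 →
        ‖N (n / r) r‖ ≤ cW * t ^ 4 * (ell D ^ 4)⁻¹ * ((n : ℝ) / Nat.totient n) ^ 2 := by
      intro hw
      rw [hnr, prod_one_sub_inv_inv_sq_eq (hSne n hn)] at hw
      rw [hNeq]
      calc ‖frakv2 c' χ j (n / r) r‖ ≤ 16 * |C₁| * t ^ 4 * (ell D ^ 4)⁻¹ * ((n : ℝ) / Nat.totient n) ^ 2 :=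
            hw.trans (mul_le_mul_of_nonneg_right hrate (by positivity))
        _ ≤ _ := by rw [hcW]; gcongr; linarith [Real.exp_pos (9 / 2), abs_nonneg C₃]
    rcases hmain with h | h
    · -- `n = P^{0.502}`: second window of (10.11)
      refine from_window (H₁' (n / r) r hd1 hr0 ?_)
      rw [hcast]
      right; left
      exact ⟨lt_of_lt_of_le (div_lt_self hlo0 hT1') hlon, h⟩
    · rcases lt_or_eq_of_le h with h' | h'
      · -- `n > P₁/T`: third window of (10.11)
        refine from_window (H₁' (n / r) r hd1 hr0 ?_)
        rw [hcast]
        right; right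
        exact ⟨h', hnhi⟩
      · -- `n = P₁/T`: (10.10) gives the main-term form; bound it crudely
        have h10 := H₃' (n / r) r hd1 hr0 (by rw [hcast, ← h']; exact hlohiT)
          (by rw [hcast, ← h'])
        rw [hcast, hnr, prod_one_sub_inv_inv_sq_eq (hSne n hn)] at h10
        have hPiW := norm_PiW_le χ (d := n / r) (r := r) (by omega) (by omega)
        rw [hnr] at hPiW
        have hG2 : ‖(1 : ℂ) + fraky2 c' D j n‖ ≤ 2 := by
          have := hG n hn; rw [hGdef] at this; exact this
        have hmainterm : ‖500 * deriv χ.LFunction 1 * PiW χ (n / r) r / (Real.log P : ℂ) *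
            (1 + fraky2 c' D j n)‖ ≤ 4000 * Real.exp (9 / 2) * (ell D ^ 7)⁻¹ *
              ((n : ℝ) / Nat.totient n) ^ 2 := by
          have e : 500 * deriv χ.LFunction 1 * PiW χ (n / r) r / (Real.log P : ℂ) *
              (1 + fraky2 c' D j n) = c₀ * PiW χ (n / r) r * (1 + fraky2 c' D j n) := by
            rw [hc₀def]; ring
          rw [e, norm_mul, norm_mul]
          calc ‖c₀‖ * ‖PiW χ (n / r) r‖ * ‖(1 : ℂ) + fraky2 c' D j n‖
              ≤ (2000 * Real.exp (9 / 2) * (ell D ^ 7)⁻¹) * ((n : ℝ) / Nat.totient n) ^ 2 * 2 := by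
                gcongr
            _ = 4000 * Real.exp (9 / 2) * (ell D ^ 7)⁻¹ * ((n : ℝ) / Nat.totient n) ^ 2 := by ring
        rw [hNeq]
        have hsplit : ‖frakv2 c' χ j (n / r) r‖ ≤
            ‖500 * deriv χ.LFunction 1 * PiW χ (n / r) r / (Real.log P : ℂ) * (1 + fraky2 c' D j n)‖ +
              C₃ * (ell D ^ 15)⁻¹ * ((n : ℝ) / Nat.totient n) ^ 2 := by
          have := norm_le_norm_add_norm_sub' (frakv2 c' χ j (n / r) r)
            (500 * deriv χ.LFunction 1 * PiW χ (n / r) r / (Real.log P : ℂ) * (1 + fraky2 c' D j n))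
          linarith
        calc ‖frakv2 c' χ j (n / r) r‖
            ≤ 4000 * Real.exp (9 / 2) * (t ^ 4 * (ell D ^ 4)⁻¹) * ((n : ℝ) / Nat.totient n) ^ 2 +
              |C₃| * (t ^ 4 * (ell D ^ 4)⁻¹) * ((n : ℝ) / Nat.totient n) ^ 2 := by
              refine hsplit.trans (add_le_add (hmainterm.trans ?_) ?_)
              · gcongr
              · calc C₃ * (ell D ^ 15)⁻¹ * ((n : ℝ) / Nat.totient n) ^ 2
                    ≤ |C₃| * (ell D ^ 15)⁻¹ * ((n : ℝ) / Nat.totient n) ^ 2 := by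
                      gcongr; exact le_abs_self _
                  _ ≤ |C₃| * (t ^ 4 * (ell D ^ 4)⁻¹) * ((n : ℝ) / Nat.totient n) ^ 2 := by gcongr
          _ = (4000 * Real.exp (9 / 2) + |C₃|) * t ^ 4 * (ell D ^ 4)⁻¹ *
                ((n : ℝ) / Nat.totient n) ^ 2 := by ring
          _ ≤ cW * t ^ 4 * (ell D ^ 4)⁻¹ * ((n : ℝ) / Nat.totient n) ^ 2 := by
              rw [hcW]; gcongr; linarith [abs_nonneg C₁]
  -- (B6) collapse
  have hPi : ∀ n ∈ S, main n →
      ∑ r ∈ n.divisors with Squarefree r, (1 / (Nat.totient r : ℂ)) * PiW χ (n / r) r =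
        (n : ℂ) / (Nat.totient n : ℂ) := fun n hn _ => h810 D χ hq n (hSne n hn)
  -- (C) abstract assembly (window variant)
  have heM0 : 0 ≤ |C₂| * (ell D ^ 6)⁻¹ / (0.504 * ell D ^ 9) := by positivity
  have hBM0 : 0 ≤ 4 * Real.exp (9 / 2) * ell D ^ 2 * 32 / (0.504 * ell D ^ 9) := by positivity
  have hBW0 : (0 : ℝ) ≤ 4 * Real.exp (9 / 2) * ell D ^ 2 * 32 / (0.504 * ell D ^ 9) +
      |C₂| * (ell D ^ 6)⁻¹ / (0.504 * ell D ^ 9) + 4 * t ^ 2 * (ell D ^ 7)⁻¹ := by positivity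
  have hRA := range_assembly_bound₃ hSne main a M M₀ G N (PiW χ) c₀ heM0 hBM0 hBW0 hPi hM hM₀
    hMW hG hN hW
  -- (D) main term, weights, constants
  have hMT : 500 * deriv χ.LFunction 1 ^ 2 / (0.504 * Sec10B.logP D ^ 2) *
        Sec10B.nAvg c' χ j lo hi
          (fun n => frakfW c' D j 6 (hi / n) * (1 + fraky2 c' D j n)) =
      ∑ n ∈ S, a n * ((n : ℂ) / (Nat.totient n : ℂ)) * (M₀ n * c₀ * G n) := by
    rw [hadef, hM₀def, hGdef, hc₀def]
    exact hMT0
  have hweight : ∀ n ∈ S, ∀ k : ℕ, ‖a n‖ * ((n : ℝ) / Nat.totient n) ^ k ≤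
      ((n : ℝ) / Nat.totient n) ^ (k + 4) / n := by
    intro n hn k
    have hn0 := hSne n hn
    have hnpos : (0 : ℝ) < n := by exact_mod_cast Nat.pos_of_ne_zero hn0
    have hχ : ‖χ (n : ZMod D)‖ ≤ 1 := DirichletCharacter.norm_le_one χ _
    have hlam := norm_lamZero_le c' D j hn0
    have hr1 := one_le_self_div_totient hn0
    rw [hadef]
    simp only
    rw [norm_div, norm_mul, Complex.norm_real, Real.norm_eq_abs, abs_norm, Complex.norm_natCast]
    calc ‖χ (n : ZMod D)‖ * ‖lamZero c' D j n‖ / n * ((n : ℝ) / Nat.totient n) ^ k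
        ≤ 1 * ((n : ℝ) / Nat.totient n) ^ 4 / n * ((n : ℝ) / Nat.totient n) ^ k := by gcongr
      _ = ((n : ℝ) / Nat.totient n) ^ (k + 4) / n := by ring
  have hWmain_le : ∑ n ∈ S.filter main, ‖a n‖ * ((n : ℝ) / Nat.totient n) ^ 3 ≤
      Real.exp 256 * ell D ^ 9 := by
    have hfull := weight_sum_exp_range 7 (A := 0.502 * ell D ^ 9) (B := 0.504 * ell D ^ 9)
      (by linarith [h59]) (by linarith [h59]) S (fun n hn => by
        obtain ⟨h1, h2, h3⟩ := hmemS hn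
        rw [hlo_exp] at h2; rw [hhi_exp] at h3
        exact ⟨h1, h2, h3⟩)
    have h256' : Real.exp (2 ^ (7 + 1)) = Real.exp 256 := by norm_num
    rw [h256'] at hfull
    calc ∑ n ∈ S.filter main, ‖a n‖ * ((n : ℝ) / Nat.totient n) ^ 3
        ≤ ∑ n ∈ S.filter main, ((n : ℝ) / Nat.totient n) ^ 7 / n :=
          Finset.sum_le_sum fun n hn => hweight n (Finset.mem_of_mem_filter n hn) 3
      _ ≤ ∑ n ∈ S, ((n : ℝ) / Nat.totient n) ^ 7 / n :=
          Finset.sum_le_sum_of_subset_of_nonneg (Finset.filter_subset _ _) fun n _ _ => by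
            positivity
      _ ≤ Real.exp 256 * (2 + (0.504 * ell D ^ 9 - 0.502 * ell D ^ 9)) := hfull
      _ ≤ Real.exp 256 * ell D ^ 9 := by gcongr; linarith [h59]
  have hWwin_le : ∑ n ∈ S.filter (fun n => ¬ main n), ‖a n‖ * ((n : ℝ) / Nat.totient n) ^ 3 ≤
      2 * Real.exp 256 * ell D * t := by
    have hwin := weight_sum_windows 7 (A := 0.502 * ell D ^ 9) (B := 0.504 * ell D ^ 9)
      (τ := ell D ^ (1.1 : ℝ)) (by linarith [h59]) (by positivity)
      (by have h2pos : 0 < ell D ^ 2 := pow_pos hL0 2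
          linarith [h11, h7L])
      (S.filter (fun n => ¬ main n)) (fun n hn => by
        rw [Finset.mem_filter] at hn
        obtain ⟨hnS, hnm⟩ := hn
        obtain ⟨h1, h2, h3⟩ := hmemS hnS
        rw [hmaindef] at hnm
        simp only [not_and_or, not_lt] at hnm
        refine ⟨h1, ?_⟩
        rcases hnm with h | h
        · left; rw [← hlo_exp]; exact ⟨h2, h⟩
        · right
          rw [← hhiT_exp, ← hhi_exp]
          exact ⟨h, h3⟩)
    have h256 : Real.exp (2 ^ (7 + 1)) = Real.exp 256 := by norm_num
    rw [h256] at hwin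
    calc ∑ n ∈ S.filter (fun n => ¬ main n), ‖a n‖ * ((n : ℝ) / Nat.totient n) ^ 3
        ≤ ∑ n ∈ S.filter (fun n => ¬ main n), ((n : ℝ) / Nat.totient n) ^ 7 / n :=
          Finset.sum_le_sum fun n hn => hweight n (Finset.mem_of_mem_filter n hn) 3
      _ ≤ Real.exp 256 * (5 + ell D ^ (1.1 : ℝ)) := hwin
      _ ≤ Real.exp 256 * (2 * (ell D * t)) := by
          gcongr
          rw [hτ]
          have : 5 ≤ ell D * t := by
            calc (5 : ℝ) ≤ ell D * 1 := by linarith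
              _ ≤ ell D * t := by gcongr
          linarith
      _ = 2 * Real.exp 256 * ell D * t := by ring
  obtain ⟨hKmain, -⟩ := consts_bound_top (C₁ := C₃) (C₂ := C₂) hL5 (norm_nonneg c₀) hc₀'
  have hKwin := consts_bound_weak (C₂ := C₂) hL1 ht1 hcW0 (norm_nonneg c₀) hc₀'
  -- (E) conclusion
  rw [hreidx, hMT]
  refine hRA.trans ?_
  rw [hαeq]
  rw [hY] at htY
  exact final_bound_weak (m := 6) (by norm_num) ht1 hLt10 hε hK₁0 hK₂0 (by positivity)
    (by positivity) hWmain_le hWwin_le hKmain hKwin hLmain htY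

/-- **`Z22:§10.u038` (first line) from the re-typed §10 binder** (RT-01′ of record, R-26):
`Skeleton.Lemma102RelW c′ → Lemma82 c′ → Eq810 → Typed.Sec10B.Eq1038a c′` (clauses 3 and 4 of the binder).
[cite: Zhang2022LandauSiegel, §10 p. 57] -/
theorem eq1038a_of_lemma102RelW (h : Lemma102RelW c') (h82 : Lemma82 c')
    (h810 : Section8cStatements.Eq810) : Sec10B.Eq1038a c' := by
  obtain ⟨C, hC⟩ := h
  refine eq1038a_of_rel_clauses c' ⟨C, hC.mono ?_⟩ ⟨C, hC.mono ?_⟩ h82 h810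
  · intro D _ χ _ _ h hA j hj d r hd hr h1 h2
    exact (h hA j hj d r hd hr).2.2.1 h1 h2
  · intro D _ χ _ _ h hA j hj d r hd hr hw
    exact (h hA j hj d r hd hr).2.2.2 hw

/-- **`Z22:§10.u038` (first line) HOLDS for `c′ ≥ 0`**: `Typed.Sec10B.Eq1038a c′` OUTRIGHT — (10.10)ᴿ and
the window bound are zl-w10-p6's theorems from `Lemma83Rel` (`Lemma102.eq1010Rel_of_lemma83Rel`,
`Lemma102.frakv2_windows_le_of_lemma83Rel`; `𝓛(1+𝓛^{1.1})⁴(𝓛⁹)⁻¹ = 𝓛(1+log T)⁴/log P`), `Lemma83Rel c′`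
is the tree's `lemma83Rel_holds` (App. A closed), Lemma 8.2 is `lemma82_holds` (`c′ ≥ 0`), (8.10) is
`Section8FrontEnd810.eq810_holds`. [cite: Zhang2022LandauSiegel, §10 p. 57] -/
theorem eq1038a_holds {c' : ℝ} (hc' : 0 ≤ c') : Sec10B.Eq1038a c' := by
  have h83 := lemma83Rel_holds c'
  obtain ⟨C, hC⟩ := Lemma102.frakv2_windows_le_of_lemma83Rel h83
  refine eq1038a_of_rel_clauses c' (Lemma102.eq1010Rel_of_lemma83Rel h83) ⟨C, hC.mono ?_⟩
    (lemma82_holds hc') Section8FrontEnd810.eq810_holds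
  intro D _ χ _ _ h hA j hj d r hd hr hw
  have e : C * (ell D * (1 + ell D ^ (1.1 : ℝ)) ^ 4 * (ell D ^ 9)⁻¹) =
      C * ell D * (1 + Real.log (bigT D)) ^ 4 / Real.log (bigP D) := by
    rw [bigT, bigP, Real.log_exp, Real.log_exp]; ring
  rw [← e]
  exact h hA j hj d r hd hr hw

/-- The all-`c′` packaging used by the skeleton pen: `∀ c′, 0 ≤ c′ → Eq1038a c′`.
[cite: Zhang2022LandauSiegel, §10 p. 57] -/
theorem eq1038a_holds_all : ∀ c' : ℝ, 0 ≤ c' → Sec10B.Eq1038a c' := fun _ hc' => eq1038a_holds hc'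

end Literature.NumberTheory.LFunctions.Zhang2022.Skeleton
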